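import Literature.Algebra.Homology.GroupCohomologyModPiFinite
import Mathlib.Algebra.Module.Torsion.Basic
import HarnessLib

/-!
# The `ϖ`-torsion of `H¹(G, A)` is bounded by `H¹(G, A[ϖ])` and `H⁰(G, A/ϖA)`

Topic `Algebra/Homology`; namespace `Literature.Algebra.Homology`; definitions with bodies and
theorems (no named fact, no `sorry`).  For a representation `A` of a group `G` over a commutative
ring `k` and `ϖ ∈ k`, multiplication by `ϖ` on `A` factors as

  `A ↠ A/A[ϖ] ↪ A`  (`[a] ↦ ϖ a`),

so on `H¹(G, A)` it factors through `H¹(G, A/A[ϖ])`; the two kernels are controlled by the long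
exact sequences of `0 → A[ϖ] → A → A/A[ϖ] → 0` (at `H¹(A)`: image of `H¹(G, A[ϖ])`) and of
`0 → A/A[ϖ] → A → A/ϖA → 0` (at `H¹(A/A[ϖ])`: image of the connecting map from `H⁰(G, A/ϖA)`).
Hence (`finite_torsionBy_groupCohomology_one`):

  **`#{x ∈ H¹(G, A) : ϖ x = 0} ≤ #H¹(G, A[ϖ]) · #H⁰(G, A/ϖA)`** (both sides finite when the right is).

This is the uniform bound on the `p`-torsion of `H¹` with coefficients in a lattice modulo `pⁿ`
(where `A[p] ≅ A/pA ≅` the lattice modulo `p`, independently of `n`) used in Hida's control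
theorem ([Hida1994AIF, §3]; [KhareThorne2017, §6.4–6.5]).
[Brown1982CohomologyGroups, III.6 Prop. 6.1 (long exact sequence)]

## References

* K. S. Brown, *Cohomology of Groups*, GTM 87 (1982), III.6 (held). [Brown1982CohomologyGroups]
* H. Hida, Ann. Inst. Fourier 44 (1994), §3 (held). [Hida1994AIF]
-/

noncomputable section

open CategoryTheory groupCohomology
open scoped Pointwise

namespace Literature.Algebra.Homology

universe u

/-! ### Kernels of composites -/

/-- **`#ker (g ∘ f) ≤ #ker f · #ker g`** (and `ker (g ∘ f)` is finite when `ker f`, `ker g` are).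
[folklore] -/
theorem finite_ker_comp_and_natCard_le {k : Type*} [Semiring k] {M N P : Type*} [AddCommGroup M] [Module k M]
    [AddCommGroup N] [Module k N] [AddCommGroup P] [Module k P] (f : M →ₗ[k] N) (g : N →ₗ[k] P)
    [Finite (LinearMap.ker f)] [Finite (LinearMap.ker g)] :
    Finite (LinearMap.ker (g ∘ₗ f)) ∧
      Nat.card (LinearMap.ker (g ∘ₗ f)) ≤ Nat.card (LinearMap.ker f) * Nat.card (LinearMap.ker g) := by
  classical
  set K := LinearMap.ker (g ∘ₗ f) with hK
  -- `h : K → ker g`, `x ↦ f x`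
  have hmem : ∀ x : K, f x.1 ∈ LinearMap.ker g := fun x => by
    have hx : x.1 ∈ LinearMap.ker (g ∘ₗ f) := x.2
    rw [LinearMap.mem_ker, LinearMap.comp_apply] at hx
    exact hx
  let h : K → LinearMap.ker g := fun x => ⟨f x.1, hmem x⟩
  -- a set-theoretic section of `h` over its image
  have hsec : ∀ y : Set.range h, ∃ x : K, h x = y.1 := fun y => y.2
  choose s hs using hsec
  let e : K → LinearMap.ker f × LinearMap.ker g := fun x =>
    (⟨x.1 - (s ⟨h x, x, rfl⟩).1, by
      have h1 : f (s ⟨h x, x, rfl⟩).1 = f x.1 := congrArg Subtype.val (hs ⟨h x, x, rfl⟩)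
      rw [LinearMap.mem_ker, map_sub, h1, sub_self]⟩, h x)
  have he : Function.Injective e := by
    intro x y hxy
    have h2 : h x = h y := congrArg Prod.snd hxy
    have h1 : x.1 - (s ⟨h x, x, rfl⟩).1 = y.1 - (s ⟨h y, y, rfl⟩).1 := congrArg (fun q => (q.1 : M)) hxy
    have h3 : (s ⟨h x, x, rfl⟩).1 = (s ⟨h y, y, rfl⟩).1 := by
      have : (⟨h x, x, rfl⟩ : Set.range h) = ⟨h y, y, rfl⟩ := Subtype.ext h2
      rw [this]
    rw [h3, sub_left_inj] at h1
    exact Subtype.ext h1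
  haveI : Finite K := Finite.of_injective e he
  refine ⟨this, ?_⟩
  rw [← Nat.card_prod]
  exact Nat.card_le_card_of_injective e he

variable {k G : Type u} [CommRing k] [Group G] (A : Rep k G) (ϖ : k)

/-! ### `A[ϖ]`, `A/A[ϖ]`, `A/ϖA` and the factorisation of `ϖ` -/

/-- `A[ϖ]` is `G`-stable. [folklore] -/
theorem torsionBy_le_comap (g : G) :
    Submodule.torsionBy k A.V ϖ ≤ (Submodule.torsionBy k A.V ϖ).comap (A.ρ g) := fun v hv => by
  rw [Submodule.mem_comap, Submodule.mem_torsionBy_iff, ← map_smul, (Submodule.mem_torsionBy_iff _ _).1 hv,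
    map_zero]

/-- **`A[ϖ]`**, the `ϖ`-torsion subrepresentation. [folklore] -/
abbrev torsionRep : Rep k G := A.subrepresentation (Submodule.torsionBy k A.V ϖ) (torsionBy_le_comap A ϖ)

/-- **`A/A[ϖ]`**. [folklore] -/
abbrev modTorsionRep : Rep k G := A.quotient (Submodule.torsionBy k A.V ϖ) (torsionBy_le_comap A ϖ)

/-- **`A/ϖA`**. [folklore] -/
abbrev modSMulRep : Rep k G := A.quotient (ϖ • ⊤) (smul_top_le_comap A ϖ)

/-- `ker (ϖ ·) = A[ϖ]`. [folklore] -/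
theorem torsionBy_eq_ker_smul_id :
    Submodule.torsionBy k A.V ϖ = LinearMap.ker (ϖ • LinearMap.id : A.V →ₗ[k] A.V) :=
  Submodule.ext fun v => by rw [Submodule.mem_torsionBy_iff, LinearMap.mem_ker]; rfl

/-- **`j : A/A[ϖ] → A`, `[a] ↦ ϖ a`**, a morphism of representations. [folklore] -/
def mulOfModTorsion : modTorsionRep A ϖ ⟶ A :=
  Rep.ofHom ⟨(Submodule.torsionBy k A.V ϖ).liftQ (ϖ • LinearMap.id) (torsionBy_eq_ker_smul_id A ϖ).le, fun g => by
    refine Submodule.linearMap_qext _ (LinearMap.ext fun v => ?_)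
    change (Submodule.torsionBy k A.V ϖ).liftQ (ϖ • LinearMap.id) (torsionBy_eq_ker_smul_id A ϖ).le
        ((Submodule.torsionBy k A.V ϖ).mapQ (Submodule.torsionBy k A.V ϖ) (A.ρ g) (torsionBy_le_comap A ϖ g)
          (Submodule.Quotient.mk v)) =
      A.ρ g ((Submodule.torsionBy k A.V ϖ).liftQ (ϖ • LinearMap.id) (torsionBy_eq_ker_smul_id A ϖ).le
        (Submodule.Quotient.mk v))
    rw [Submodule.mapQ_apply, Submodule.liftQ_apply, Submodule.liftQ_apply, LinearMap.smul_apply,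
      LinearMap.smul_apply, LinearMap.id_apply, LinearMap.id_apply, map_smul]⟩

/-- `j [a] = ϖ a`. [folklore] -/
theorem mulOfModTorsion_hom_mk (v : A.V) :
    (mulOfModTorsion A ϖ).hom (Submodule.Quotient.mk v) = ϖ • v :=
  rfl

/-- **`(A ↠ A/A[ϖ]) ≫ j = ϖ · 𝟙_A`.** [folklore] -/
theorem mkQ_comp_mulOfModTorsion :
    A.mkQ (Submodule.torsionBy k A.V ϖ) (torsionBy_le_comap A ϖ) ≫ mulOfModTorsion A ϖ = ϖ • 𝟙 A :=
  Rep.hom_ext (Representation.IntertwiningMap.ext (LinearMap.ext fun _ => rfl))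

/-- `subtype ≫ mkQ = 0`. [folklore] -/
theorem subtype_comp_mkQ :
    A.subtype (Submodule.torsionBy k A.V ϖ) (torsionBy_le_comap A ϖ) ≫
      A.mkQ (Submodule.torsionBy k A.V ϖ) (torsionBy_le_comap A ϖ) = 0 :=
  Rep.hom_ext (Representation.IntertwiningMap.ext (LinearMap.ext fun v =>
    (Submodule.Quotient.mk_eq_zero _).2 v.2))

/-- `j ≫ (A ↠ A/ϖA) = 0`. [folklore] -/
theorem mulOfModTorsion_comp_mkQ :
    mulOfModTorsion A ϖ ≫ A.mkQ (ϖ • ⊤) (smul_top_le_comap A ϖ) = 0 := by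
  refine Rep.hom_ext (Representation.IntertwiningMap.ext (Submodule.linearMap_qext _ (LinearMap.ext fun v => ?_)))
  change Submodule.Quotient.mk (ϖ • v) = (0 : A.V ⧸ (ϖ • ⊤ : Submodule k A.V))
  exact (Submodule.Quotient.mk_eq_zero _).2 (Submodule.smul_mem_pointwise_smul _ _ _ Submodule.mem_top)

/-- **`0 → A[ϖ] → A → A/A[ϖ] → 0` is short exact.** [folklore] -/
theorem shortExact_torsion :
    (ShortComplex.mk (A.subtype (Submodule.torsionBy k A.V ϖ) (torsionBy_le_comap A ϖ))
      (A.mkQ (Submodule.torsionBy k A.V ϖ) (torsionBy_le_comap A ϖ)) (subtype_comp_mkQ A ϖ)).ShortExact where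
  exact := (forget₂ (Rep k G) (ModuleCat k)).reflects_exact_of_faithful _ <|
    (ShortComplex.moduleCat_exact_iff _).2 fun v hv =>
      ⟨⟨v, (Submodule.Quotient.mk_eq_zero _).1 hv⟩, rfl⟩
  mono_f := (Rep.mono_iff_injective _).2 Subtype.val_injective
  epi_g := (Rep.epi_iff_surjective _).2 <| Submodule.mkQ_surjective _

/-- **`0 → A/A[ϖ] →j A → A/ϖA → 0` is short exact.** [folklore] -/
theorem shortExact_mulOfModTorsion :
    (ShortComplex.mk (mulOfModTorsion A ϖ) (A.mkQ (ϖ • ⊤) (smul_top_le_comap A ϖ))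
      (mulOfModTorsion_comp_mkQ A ϖ)).ShortExact where
  exact := (forget₂ (Rep k G) (ModuleCat k)).reflects_exact_of_faithful _ <|
    (ShortComplex.moduleCat_exact_iff _).2 fun v hv => by
      obtain ⟨w, -, hw⟩ := (Submodule.mem_smul_pointwise_iff_exists _ _ _).1
        ((Submodule.Quotient.mk_eq_zero _).1 hv)
      exact ⟨Submodule.Quotient.mk w, hw⟩
  mono_f := (Rep.mono_iff_injective _).2 <| LinearMap.ker_eq_bot.1 <|
    Submodule.ker_liftQ_eq_bot' _ _ (torsionBy_eq_ker_smul_id A ϖ)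
  epi_g := (Rep.epi_iff_surjective _).2 <| Submodule.mkQ_surjective _

/-! ### The bound -/

/-- `ϖ` on `Hⁿ(G, A)` factors through `Hⁿ(G, A/A[ϖ])`. [folklore] -/
theorem map_mulOfModTorsion_map_mkQ (n : ℕ) (x : groupCohomology A n) :
    map (MonoidHom.id G) (A := modTorsionRep A ϖ) (B := A) (mulOfModTorsion A ϖ) n
      (map (MonoidHom.id G) (A := A) (B := modTorsionRep A ϖ)
        (A.mkQ (Submodule.torsionBy k A.V ϖ) (torsionBy_le_comap A ϖ)) n x) = ϖ • x := by
  have h2 : map (MonoidHom.id G) (A := A) (B := modTorsionRep A ϖ)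
        (A.mkQ (Submodule.torsionBy k A.V ϖ) (torsionBy_le_comap A ϖ)) n ≫
      map (MonoidHom.id G) (A := modTorsionRep A ϖ) (B := A) (mulOfModTorsion A ϖ) n =
      map (MonoidHom.id G) (ϖ • 𝟙 A) n := by
    rw [← mkQ_comp_mulOfModTorsion, groupCohomology.map_id_comp]
  rw [← ModuleCat.comp_apply, h2, map_smul_id_apply]

/-- **`#{x ∈ H¹(G, A) : ϖ x = 0} ≤ #H¹(G, A[ϖ]) · #H⁰(G, A/ϖA)`**, and the left side is finite when
the right side is. [cite: Brown1982CohomologyGroups, III.6 Prop. 6.1] [cite: Hida1994AIF, §3] -/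
theorem finite_torsionBy_groupCohomology_one [Finite (groupCohomology (torsionRep A ϖ) 1)]
    [Finite (groupCohomology (modSMulRep A ϖ) 0)] :
    Finite (Submodule.torsionBy k (groupCohomology A 1) ϖ) ∧
      Nat.card (Submodule.torsionBy k (groupCohomology A 1) ϖ) ≤
        Nat.card (groupCohomology (torsionRep A ϖ) 1) * Nat.card (groupCohomology (modSMulRep A ϖ) 0) := by
  set f := (map (MonoidHom.id G) (A := A) (B := modTorsionRep A ϖ)
    (A.mkQ (Submodule.torsionBy k A.V ϖ) (torsionBy_le_comap A ϖ)) 1).hom with hf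
  set g := (map (MonoidHom.id G) (A := modTorsionRep A ϖ) (B := A) (mulOfModTorsion A ϖ) 1).hom with hg
  -- `ker f = im H¹(A[ϖ])`
  have hkerf : LinearMap.ker f =
      LinearMap.range (map (MonoidHom.id G) (A := torsionRep A ϖ) (B := A)
        (A.subtype (Submodule.torsionBy k A.V ϖ) (torsionBy_le_comap A ϖ)) 1).hom :=
    (mapShortComplex₂_exact (shortExact_torsion A ϖ) 1).moduleCat_range_eq_ker.symm
  -- `ker g = im δ⁰(A/ϖA)`
  have hkerg : LinearMap.ker g = LinearMap.range (δ (shortExact_mulOfModTorsion A ϖ) 0 1 (zero_add 1)).hom :=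
    (mapShortComplex₁_exact (shortExact_mulOfModTorsion A ϖ) (zero_add 1)).moduleCat_range_eq_ker.symm
  haveI : Finite (LinearMap.ker f) := by
    rw [hkerf]
    exact Finite.of_surjective _ (LinearMap.surjective_rangeRestrict _)
  haveI : Finite (LinearMap.ker g) := by
    rw [hkerg]
    exact Finite.of_surjective _ (LinearMap.surjective_rangeRestrict _)
  have hcf : Nat.card (LinearMap.ker f) ≤ Nat.card (groupCohomology (torsionRep A ϖ) 1) := by
    rw [hkerf]
    exact Nat.card_le_card_of_surjective _ (LinearMap.surjective_rangeRestrict _)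
  have hcg : Nat.card (LinearMap.ker g) ≤ Nat.card (groupCohomology (modSMulRep A ϖ) 0) := by
    rw [hkerg]
    exact Nat.card_le_card_of_surjective _ (LinearMap.surjective_rangeRestrict _)
  have heq : Submodule.torsionBy k (groupCohomology A 1) ϖ = LinearMap.ker (g ∘ₗ f) := by
    refine Submodule.ext fun x => ?_
    rw [Submodule.mem_torsionBy_iff, LinearMap.mem_ker, LinearMap.comp_apply, hf, hg]
    change _ ↔ map (MonoidHom.id G) (A := modTorsionRep A ϖ) (B := A) (mulOfModTorsion A ϖ) 1
      (map (MonoidHom.id G) (A := A) (B := modTorsionRep A ϖ)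
        (A.mkQ (Submodule.torsionBy k A.V ϖ) (torsionBy_le_comap A ϖ)) 1 x) = 0
    rw [map_mulOfModTorsion_map_mkQ]
  obtain ⟨hfin, hcard⟩ := finite_ker_comp_and_natCard_le f g
  rw [heq]
  exact ⟨hfin, hcard.trans (Nat.mul_le_mul hcf hcg)⟩

end Literature.Algebra.Homology
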